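import Mathlib.Data.ZMod.Basic
import Mathlib.Algebra.CharP.Two
import Mathlib.Data.Finsupp.Basic
import Mathlib.Algebra.BigOperators.Group.Finset.Basic
import Mathlib.Order.SymmDiff
import Mathlib.Analysis.SpecialFunctions.Pow.Real
import HarnessLib

/-!
# Grigoriev–Schoenebeck pseudo-moments from boundary expansion, I: XOR derivations

Trunk Literature/Computability/MetaComplexity; support for discharging `kmow_sos_random_kSAT`
(`SumOfSquares.lean`). This file is the purely combinatorial core of the Grigoriev (2001) /
Schoenebeck (2008) degree lower bound for Positivstellensatz/Lasserre refutations of XOR systems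
on expanding hypergraphs, in the "bounded-size derivation" form (Barak–Steurer's presentation):

* parity vectors `ParityVec = ℕ →₀ ZMod 2` (finite sets of variables under symmetric difference),
  `indVec A` the indicator of a finite set; for a family of scope vectors `g : ι → ParityVec` and a
  finite family of indices `F`, `famVec g F = Σ_{i ∈ F} g i` (the symmetric difference of the
  scopes) and `famSign b F = ∏_{i ∈ F} b i` (the product of the right-hand sides `b i = ±1`);
* `VecExpands g r c`: every `F` with `|F| ≤ r` has `|supp (famVec g F)| ≥ c |F|` (implied by
  boundary expansion of the scopes, since a unique neighbour of `F` has odd degree — proved in the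
  sequel, which imports `ScopeExpansion`);
* `IsWitness g r T F` (`|F| ≤ r`, `famVec g F = T`), `Derivable g r d T` (`|supp T| ≤ d` and a
  witness exists) and the PSEUDO-MOMENT `pseudoMoment g b r d T` = the sign of the witness (else `0`).
  Under expansion with `d ≤ c r / 2` witnesses of low-degree vectors are small (`≤ r/2`) hence
  UNIQUE (`isWitness_unique`), so pseudo-moments are well defined, multiplicative under addition
  of derivable vectors (`pseudoMoment_add`), and shift by one scope multiplies by its sign
  (`pseudoMoment_index_add`).

Positive semidefiniteness and the polynomial side are in the sequel files.

## References

* D. Grigoriev, *Linear lower bound on degrees of Positivstellensatz calculus proofs for the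
  parity*, Theoret. Comput. Sci. 259 (2001) 613–622, §2 (the construction for Tseitin/parity).
* G. Schoenebeck, *Linear level Lasserre lower bounds for certain k-CSPs*, FOCS 2008, §4
  (Thm. 4.1 / Lemma 4.4: expansion ⇒ no low-width XOR refutation ⇒ Lasserre vectors).
* B. Barak, D. Steurer, *Proofs, beliefs, and algorithms through the lens of sum-of-squares*
  (lecture notes, 2016), lecture "Lower bounds for random 3XOR/3SAT" (pseudo-distribution from
  bounded-size derivations).
* P. K. Kothari, R. Mori, R. O'Donnell, D. Witmer, arXiv:1701.04521, §3.1 (closures) — the general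
  `t`-wise-uniform version of the same construction.
-/

noncomputable section

open Finset
open scoped symmDiff

namespace Literature.Computability.MetaComplexity

/-! ### Parity vectors -/

/-- Parity vectors: finitely supported `𝔽₂`-valued functions on the variables, i.e. finite sets of
variables under symmetric difference (the monomials `∏_{v ∈ T} y_v` in `±1` variables).
[Grigoriev 2001, §2; Schoenebeck 2008, §4] [folklore] -/
abbrev ParityVec : Type := ℕ →₀ ZMod 2

/-- The indicator parity vector of a finite set of variables. [folklore] -/
def indVec (A : Finset ℕ) : ParityVec :=
  Finsupp.onFinset A (fun v => if v ∈ A then 1 else 0) fun v hv => by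
    by_contra h
    simp [h] at hv

/-- Values of the indicator vector. [folklore] -/
@[simp] theorem indVec_apply (A : Finset ℕ) (v : ℕ) : indVec A v = if v ∈ A then 1 else 0 := by
  simp [indVec]

/-- The support of the indicator vector is the set. [folklore] -/
@[simp] theorem support_indVec (A : Finset ℕ) : (indVec A).support = A := by
  ext v
  rw [Finsupp.mem_support_iff, indVec_apply]
  by_cases h : v ∈ A <;> simp [h]

/-- In characteristic two every parity vector is its own negative. [folklore] -/
@[simp] theorem ParityVec.add_self (T : ParityVec) : T + T = 0 := by
  ext v
  simp [CharTwo.add_self_eq_zero]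

/-- Cancellation `T + (T + U) = U`. [folklore] -/
@[simp] theorem ParityVec.add_add_cancel_left (T U : ParityVec) : T + (T + U) = U := by
  rw [← add_assoc, ParityVec.add_self, zero_add]

/-- `(T + U) + (U + W) = T + W`. [folklore] -/
theorem ParityVec.add_add_add_cancel (T U W : ParityVec) : (T + U) + (U + W) = T + W := by
  rw [add_assoc, ParityVec.add_add_cancel_left]

/-- The support of a sum is covered by the supports. [folklore] -/
theorem card_support_add_le (T U : ParityVec) :
    (T + U).support.card ≤ T.support.card + U.support.card :=
  (Finset.card_le_card Finsupp.support_add).trans (Finset.card_union_le _ _)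

section Families

variable {ι : Type*}

/-- The parity vector of a family of indices: `Σ_{i ∈ F} g i`, i.e. the symmetric difference of
the scopes (the left-hand side of the XOR equation obtained by adding the equations in `F`).
[Grigoriev 2001, §2; Schoenebeck 2008, §4] [folklore] -/
def famVec (g : ι → ParityVec) (F : Finset ι) : ParityVec :=
  ∑ i ∈ F, g i

/-- The sign of a family of indices: `∏_{i ∈ F} b i` (the right-hand side of the summed XOR
equation, `b i = ±1`). [Grigoriev 2001, §2; Schoenebeck 2008, §4] [folklore] -/
def famSign (b : ι → ℝ) (F : Finset ι) : ℝ :=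
  ∏ i ∈ F, b i

/-- The empty family sums to `0`. [folklore] -/
@[simp] theorem famVec_empty (g : ι → ParityVec) : famVec g ∅ = 0 := by simp [famVec]

/-- The empty family has sign `1`. [folklore] -/
@[simp] theorem famSign_empty (b : ι → ℝ) : famSign b ∅ = 1 := by simp [famSign]

/-- A single equation sums to its scope vector. [folklore] -/
@[simp] theorem famVec_singleton (g : ι → ParityVec) (i : ι) : famVec g {i} = g i := by
  simp [famVec]

/-- A single equation has its own sign. [folklore] -/
@[simp] theorem famSign_singleton (b : ι → ℝ) (i : ι) : famSign b {i} = b i := by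
  simp [famSign]

variable [DecidableEq ι]

/-- Adding the equations of `F` and of `G` gives the equation of `F ∆ G` (shared ones cancel in
characteristic two). [Grigoriev 2001, §2] [folklore] -/
theorem famVec_symmDiff (g : ι → ParityVec) (F G : Finset ι) :
    famVec g (F ∆ G) = famVec g F + famVec g G := by
  unfold famVec
  have hF : ∑ i ∈ F, g i = ∑ i ∈ F \ G, g i + ∑ i ∈ F ∩ G, g i := by
    rw [← Finset.sum_union (Finset.disjoint_sdiff_inter F G), Finset.sdiff_union_inter]
  have hG : ∑ i ∈ G, g i = ∑ i ∈ G \ F, g i + ∑ i ∈ F ∩ G, g i := by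
    rw [Finset.inter_comm, ← Finset.sum_union (Finset.disjoint_sdiff_inter G F),
      Finset.sdiff_union_inter]
  have hD : ∑ i ∈ F ∆ G, g i = ∑ i ∈ F \ G, g i + ∑ i ∈ G \ F, g i := by
    rw [symmDiff_def, Finset.sup_eq_union, Finset.sum_union disjoint_sdiff_sdiff]
  rw [hF, hG, hD]
  set A := ∑ i ∈ F \ G, g i
  set B := ∑ i ∈ G \ F, g i
  set C := ∑ i ∈ F ∩ G, g i
  calc A + B = A + B + (C + C) := by rw [ParityVec.add_self, add_zero]
    _ = A + C + (B + C) := by abel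

/-- With `±1` right-hand sides, the sign of `F ∆ G` is the product of the signs. [Grigoriev 2001,
§2] [folklore] -/
theorem famSign_symmDiff (b : ι → ℝ) (hb : ∀ i, b i * b i = 1) (F G : Finset ι) :
    famSign b (F ∆ G) = famSign b F * famSign b G := by
  unfold famSign
  have hF : ∏ i ∈ F, b i = (∏ i ∈ F \ G, b i) * ∏ i ∈ F ∩ G, b i := by
    rw [← Finset.prod_union (Finset.disjoint_sdiff_inter F G), Finset.sdiff_union_inter]
  have hG : ∏ i ∈ G, b i = (∏ i ∈ G \ F, b i) * ∏ i ∈ F ∩ G, b i := by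
    rw [Finset.inter_comm, ← Finset.prod_union (Finset.disjoint_sdiff_inter G F),
      Finset.sdiff_union_inter]
  have hD : ∏ i ∈ F ∆ G, b i = (∏ i ∈ F \ G, b i) * ∏ i ∈ G \ F, b i := by
    rw [symmDiff_def, Finset.sup_eq_union, Finset.prod_union disjoint_sdiff_sdiff]
  have hC : (∏ i ∈ F ∩ G, b i) * ∏ i ∈ F ∩ G, b i = 1 := by
    rw [← Finset.prod_mul_distrib]
    exact Finset.prod_eq_one fun i _ => hb i
  rw [hF, hG, hD]
  linear_combination -((∏ i ∈ F \ G, b i) * (∏ i ∈ G \ F, b i)) * hC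

/-- The symmetric difference is at most as large as the two families together. [folklore] -/
theorem card_symmDiff_le (F G : Finset ι) : (F ∆ G).card ≤ F.card + G.card :=
  (Finset.card_le_card (by simpa using (symmDiff_le_sup : F ∆ G ≤ F ⊔ G))).trans
    (Finset.card_union_le _ _)

/-! ### Expansion in vector form -/

/-- VECTOR EXPANSION of a family of scope vectors: adding any `≤ r` of the equations leaves at
least `c` variables per equation (the symmetric difference of `≤ r` scopes has `≥ c |F|` points).
[Schoenebeck 2008, §4 (consequence of expansion used in Lemma 4.4)] [folklore] -/
def VecExpands (g : ι → ParityVec) (r c : ℝ) : Prop :=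
  ∀ F : Finset ι, (F.card : ℝ) ≤ r → c * F.card ≤ ((famVec g F).support.card : ℝ)

/-! ### Witnesses, derivable vectors, pseudo-moments -/

/-- `F` WITNESSES `T`: at most `r` equations whose sum has left-hand side `T`.
[Barak–Steurer 2016 (3XOR lecture); Schoenebeck 2008, §4] [folklore] -/
def IsWitness (g : ι → ParityVec) (r : ℝ) (T : ParityVec) (F : Finset ι) : Prop :=
  (F.card : ℝ) ≤ r ∧ famVec g F = T

/-- `T` is DERIVABLE in degree `d`: `|supp T| ≤ d` and some family of `≤ r` equations sums to it.
[Barak–Steurer 2016 (3XOR lecture); Schoenebeck 2008, §4] [folklore] -/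
def Derivable (g : ι → ParityVec) (r : ℝ) (d : ℕ) (T : ParityVec) : Prop :=
  T.support.card ≤ d ∧ ∃ F, IsWitness g r T F

open Classical in
/-- The PSEUDO-MOMENT `Ẽ[y_T]`: the right-hand side `∏_{i ∈ F} b i` of a witnessing family if `T`
is derivable in degree `d`, and `0` otherwise. (Well defined under expansion: witnesses are unique,
`pseudoMoment_eq`.) [Grigoriev 2001, §2; Schoenebeck 2008, §4; Barak–Steurer 2016] [folklore] -/
def pseudoMoment (g : ι → ParityVec) (b : ι → ℝ) (r : ℝ) (d : ℕ) (T : ParityVec) : ℝ :=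
  if h : Derivable g r d T then famSign b (Classical.choose h.2) else 0

variable {g : ι → ParityVec} {b : ι → ℝ} {r c : ℝ} {d : ℕ}

omit [DecidableEq ι] in
/-- The empty family witnesses `0`. [folklore] -/
theorem isWitness_zero_empty (hr : 0 ≤ r) : IsWitness g r 0 ∅ := ⟨by simpa using hr, by simp⟩

omit [DecidableEq ι] in
/-- A single equation witnesses its own scope vector. [folklore] -/
theorem isWitness_singleton (hr : 1 ≤ r) (i : ι) : IsWitness g r (g i) {i} :=
  ⟨by simpa using hr, by simp⟩

/-- Witnesses combine along symmetric differences. [Grigoriev 2001, §2] [folklore] -/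
theorem IsWitness.symmDiff {T₁ T₂ : ParityVec} {F₁ F₂ : Finset ι} (h₁ : IsWitness g r T₁ F₁)
    (h₂ : IsWitness g r T₂ F₂) (hF : (F₁.card : ℝ) + F₂.card ≤ r) :
    IsWitness g r (T₁ + T₂) (F₁ ∆ F₂) := by
  refine ⟨le_trans ?_ hF, by rw [famVec_symmDiff, h₁.2, h₂.2]⟩
  exact_mod_cast card_symmDiff_le F₁ F₂

omit [DecidableEq ι] in
/-- Under vector expansion, a witness of a vector of support `≤ d` has at most `d / c` equations.
[Schoenebeck 2008, Lemma 4.4; Barak–Steurer 2016] [folklore] -/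
theorem IsWitness.card_le (hexp : VecExpands g r c) (hc : 0 < c) {T : ParityVec} {F : Finset ι}
    (h : IsWitness g r T F) (hT : T.support.card ≤ d) : (F.card : ℝ) ≤ d / c := by
  rw [le_div_iff₀ hc, mul_comm]
  refine (hexp F h.1).trans ?_
  rw [h.2]
  exact_mod_cast hT

omit [DecidableEq ι] in
/-- Hence, when `d ≤ c r / 2`, such a witness has at most `r / 2` equations. [Schoenebeck 2008,
Lemma 4.4; Barak–Steurer 2016] [folklore] -/
theorem IsWitness.card_le_half (hexp : VecExpands g r c) (hc : 0 < c) (hd : (d : ℝ) ≤ c * r / 2)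
    {T : ParityVec} {F : Finset ι} (h : IsWitness g r T F) (hT : T.support.card ≤ d) :
    (F.card : ℝ) ≤ r / 2 := by
  refine (h.card_le hexp hc hT).trans ?_
  rw [div_le_iff₀ hc]
  linarith

/-- **Uniqueness of witnesses.** Two small families with the same sum differ by a family of `≤ r`
equations summing to `0`, which expansion forces to be empty. [Grigoriev 2001, §2; Schoenebeck
2008, Lemma 4.4; Barak–Steurer 2016] [folklore] -/
theorem isWitness_unique (hexp : VecExpands g r c) (hc : 0 < c) (hd : (d : ℝ) ≤ c * r / 2)
    {T : ParityVec} {F F' : Finset ι} (h : IsWitness g r T F) (h' : IsWitness g r T F')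
    (hT : T.support.card ≤ d) : F = F' := by
  have hc1 := h.card_le_half hexp hc hd hT
  have hc2 := h'.card_le_half hexp hc hd hT
  have hw := h.symmDiff h' (by linarith)
  rw [ParityVec.add_self] at hw
  have h0 := hexp (F ∆ F') hw.1
  rw [hw.2, Finsupp.support_zero, Finset.card_empty, Nat.cast_zero] at h0
  have hcard : ((F ∆ F').card : ℝ) ≤ 0 := by
    by_contra hlt
    push Not at hlt
    have := mul_pos hc hlt
    linarith
  have : (F ∆ F').card = 0 := by exact_mod_cast le_antisymm hcard (Nat.cast_nonneg _)
  rw [Finset.card_eq_zero, ← Finset.bot_eq_empty, symmDiff_eq_bot] at this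
  exact this

/-- The pseudo-moment of a derivable vector is the sign of ANY of its witnesses.
[Grigoriev 2001, §2; Barak–Steurer 2016] [folklore] -/
theorem pseudoMoment_eq (hexp : VecExpands g r c) (hc : 0 < c) (hd : (d : ℝ) ≤ c * r / 2)
    {T : ParityVec} {F : Finset ι} (h : IsWitness g r T F) (hT : T.support.card ≤ d) :
    pseudoMoment g b r d T = famSign b F := by
  have hD : Derivable g r d T := ⟨hT, F, h⟩
  rw [pseudoMoment, dif_pos hD, isWitness_unique hexp hc hd (Classical.choose_spec hD.2) h hT]

omit [DecidableEq ι] in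
/-- Non-derivable vectors have pseudo-moment `0`. [Grigoriev 2001, §2] [folklore] -/
theorem pseudoMoment_of_not {T : ParityVec} (h : ¬ Derivable g r d T) : pseudoMoment g b r d T = 0 := by
  rw [pseudoMoment, dif_neg h]

omit [DecidableEq ι] in
/-- `0` is derivable (by the empty family). [folklore] -/
theorem derivable_zero (hr : 0 ≤ r) : Derivable g r d 0 :=
  ⟨by simp, ∅, isWitness_zero_empty hr⟩

/-- Normalisation `Ẽ[1] = 1`. [Grigoriev 2001, §2] [folklore] -/
theorem pseudoMoment_zero (hexp : VecExpands g r c) (hc : 0 < c) (hd : (d : ℝ) ≤ c * r / 2)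
    (hr : 0 ≤ r) : pseudoMoment g b r d 0 = 1 := by
  rw [pseudoMoment_eq hexp hc hd (isWitness_zero_empty hr) (by simp), famSign_empty]

/-- **Multiplicativity.** If `T₁`, `T₂` are derivable and `T₁ + T₂` has support `≤ d`, then
`T₁ + T₂` is derivable and `Ẽ[y_{T₁+T₂}] = Ẽ[y_{T₁}] Ẽ[y_{T₂}]` (`b = ±1`).
[Grigoriev 2001, §2; Schoenebeck 2008, §4; Barak–Steurer 2016] [folklore] -/
theorem pseudoMoment_add (hexp : VecExpands g r c) (hc : 0 < c) (hd : (d : ℝ) ≤ c * r / 2)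
    (hb : ∀ i, b i * b i = 1) {T₁ T₂ : ParityVec} (h₁ : Derivable g r d T₁)
    (h₂ : Derivable g r d T₂) (h12 : (T₁ + T₂).support.card ≤ d) :
    Derivable g r d (T₁ + T₂) ∧
      pseudoMoment g b r d (T₁ + T₂) = pseudoMoment g b r d T₁ * pseudoMoment g b r d T₂ := by
  obtain ⟨hT₁, F₁, hF₁⟩ := h₁
  obtain ⟨hT₂, F₂, hF₂⟩ := h₂
  have hc1 := hF₁.card_le_half hexp hc hd hT₁
  have hc2 := hF₂.card_le_half hexp hc hd hT₂
  have hw := hF₁.symmDiff hF₂ (by linarith)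
  refine ⟨⟨h12, _, hw⟩, ?_⟩
  rw [pseudoMoment_eq hexp hc hd hw h12, pseudoMoment_eq hexp hc hd hF₁ hT₁,
    pseudoMoment_eq hexp hc hd hF₂ hT₂, famSign_symmDiff b hb]

/-- Derivability transfers along a derivable summand: if `T₁` is derivable then `T₂` is iff
`T₁ + T₂` is (all supports `≤ d`). [Grigoriev 2001, §2] [folklore] -/
theorem derivable_add_iff (hexp : VecExpands g r c) (hc : 0 < c) (hd : (d : ℝ) ≤ c * r / 2)
    (hb : ∀ i, b i * b i = 1) {T₁ T₂ : ParityVec} (h₁ : Derivable g r d T₁)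
    (hT₂ : T₂.support.card ≤ d) (h12 : (T₁ + T₂).support.card ≤ d) :
    Derivable g r d T₂ ↔ Derivable g r d (T₁ + T₂) := by
  refine ⟨fun h₂ => (pseudoMoment_add hexp hc hd hb h₁ h₂ h12).1, fun h => ?_⟩
  have := (pseudoMoment_add hexp hc hd hb h₁ h (by simpa using hT₂)).1
  simpa using this

/-- **One more equation.** For an index `i` (needs `r ≥ 2`): if `T` is derivable and `g i + T` has
support `≤ d`, then `g i + T` is derivable with `Ẽ[y_{g i + T}] = b i · Ẽ[y_T]`.
[Grigoriev 2001, §2; Schoenebeck 2008, §4] [folklore] -/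
theorem pseudoMoment_index_add (hexp : VecExpands g r c) (hc : 0 < c) (hd : (d : ℝ) ≤ c * r / 2)
    (hr : 2 ≤ r) (hb : ∀ i, b i * b i = 1) (i : ι) {T : ParityVec} (h : Derivable g r d T)
    (hiT : (g i + T).support.card ≤ d) :
    Derivable g r d (g i + T) ∧ pseudoMoment g b r d (g i + T) = b i * pseudoMoment g b r d T := by
  obtain ⟨hT, F, hF⟩ := h
  have hc1 := hF.card_le_half hexp hc hd hT
  have hi : IsWitness g r (g i) {i} := isWitness_singleton (by linarith) i
  have hw := hi.symmDiff hF (by simp; linarith)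
  refine ⟨⟨hiT, _, hw⟩, ?_⟩
  rw [pseudoMoment_eq hexp hc hd hw hiT, pseudoMoment_eq hexp hc hd hF hT, famSign_symmDiff b hb,
    famSign_singleton]

/-- Contrapositive form: if `T` is NOT derivable (but of support `≤ d`) then neither is
`g i + T`. [Grigoriev 2001, §2] [folklore] -/
theorem not_derivable_index_add (hexp : VecExpands g r c) (hc : 0 < c) (hd : (d : ℝ) ≤ c * r / 2)
    (hr : 2 ≤ r) (hb : ∀ i, b i * b i = 1) (i : ι) {T : ParityVec} (h : ¬ Derivable g r d T)
    (hT : T.support.card ≤ d) : ¬ Derivable g r d (g i + T) := by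
  intro h'
  have := (pseudoMoment_index_add hexp hc hd hr hb i h' (T := g i + T) (by simpa using hT)).1
  simp at this
  exact h this


/-- Derivable vectors are closed under addition in low degree (no sign hypothesis needed).
[Grigoriev 2001, §2] [folklore] -/
theorem Derivable.add (hexp : VecExpands g r c) (hc : 0 < c) (hd : (d : ℝ) ≤ c * r / 2)
    {T₁ T₂ : ParityVec} (h₁ : Derivable g r d T₁) (h₂ : Derivable g r d T₂)
    (h12 : (T₁ + T₂).support.card ≤ d) : Derivable g r d (T₁ + T₂) := by
  obtain ⟨hT₁, F₁, hF₁⟩ := h₁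
  obtain ⟨hT₂, F₂, hF₂⟩ := h₂
  have hc1 := hF₁.card_le_half hexp hc hd hT₁
  have hc2 := hF₂.card_le_half hexp hc hd hT₂
  exact ⟨h12, _, hF₁.symmDiff hF₂ (by linarith)⟩

end Families

/-! ### Positive semidefiniteness of the pseudo-moment matrix -/

section PSD

variable {ι : Type*} [DecidableEq ι] {g : ι → ParityVec} {b : ι → ℝ} {r c : ℝ} {d : ℕ}

/-- Parity vectors of "half degree": `2 |supp T| ≤ d` (the monomials indexing the moment matrix).
[Grigoriev 2001, §2] [folklore] -/
def LowVec (d : ℕ) : Type := {T : ParityVec // 2 * T.support.card ≤ d}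

/-- The Grigoriev–Schoenebeck equivalence on half-degree monomials: `T ~ T'` iff `T + T'` is
derivable. Transitivity is where `d ≤ c r / 2` enters (witnesses stay of size `≤ r/2`).
[Grigoriev 2001, §2 (proof of Lemma 2); Schoenebeck 2008, §4; Barak–Steurer 2016] [folklore] -/
def derivSetoid (g : ι → ParityVec) (r c : ℝ) (d : ℕ) (hexp : VecExpands g r c) (hc : 0 < c)
    (hd : (d : ℝ) ≤ c * r / 2) (hr : 0 ≤ r) : Setoid (LowVec d) where
  r T T' := Derivable g r d (T.1 + T'.1)
  iseqv :=
    { refl := fun T => by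
        rw [ParityVec.add_self]
        exact derivable_zero hr
      symm := fun {T T'} h => by rwa [add_comm]
      trans := fun {T₁ T₂ T₃} h12 h23 => by
        have h := Derivable.add hexp hc hd h12 h23 (by
          rw [ParityVec.add_add_add_cancel]
          have := card_support_add_le T₁.1 T₃.1
          have h1 := T₁.2; have h3 := T₃.2
          omega)
        rwa [ParityVec.add_add_add_cancel] at h }

variable (b) in
open Classical in
/-- The CLASS FUNCTION `χ(T) = Ẽ[y_{T + T₀}]` where `T₀` is the chosen representative of the class
of `T` (and `0` off the half-degree range). [Grigoriev 2001, §2; Barak–Steurer 2016] [folklore] -/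
def classSign (hexp : VecExpands g r c) (hc : 0 < c) (hd : (d : ℝ) ≤ c * r / 2) (hr : 0 ≤ r)
    (T : ParityVec) : ℝ :=
  if h : 2 * T.support.card ≤ d then
    pseudoMoment g b r d (T + (Quotient.mk (derivSetoid g r c d hexp hc hd hr) ⟨T, h⟩).out.1)
  else 0

open Classical in
/-- The CLASS of a parity vector in the quotient (`none` off the half-degree range).
[Grigoriev 2001, §2] [folklore] -/
def classOf (hexp : VecExpands g r c) (hc : 0 < c) (hd : (d : ℝ) ≤ c * r / 2) (hr : 0 ≤ r)
    (T : ParityVec) : Option (Quotient (derivSetoid g r c d hexp hc hd hr)) :=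
  if h : 2 * T.support.card ≤ d then some (Quotient.mk _ ⟨T, h⟩) else none

open Classical in
/-- **The moment matrix factors through the classes**: for half-degree `T, T'`,
`Ẽ[y_{T+T'}] = χ(T) χ(T')` if `T ~ T'` and `0` otherwise. [Grigoriev 2001, §2 (Lemma 2);
Schoenebeck 2008, §4; Barak–Steurer 2016] [folklore] -/
theorem pseudoMoment_add_eq_classSign (hexp : VecExpands g r c) (hc : 0 < c)
    (hd : (d : ℝ) ≤ c * r / 2) (hr : 0 ≤ r) (hb : ∀ i, b i * b i = 1) {T T' : ParityVec}
    (hT : 2 * T.support.card ≤ d) (hT' : 2 * T'.support.card ≤ d) :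
    pseudoMoment g b r d (T + T') =
      if classOf hexp hc hd hr T = classOf hexp hc hd hr T' then
        classSign b hexp hc hd hr T * classSign b hexp hc hd hr T' else 0 := by
  let s := derivSetoid g r c d hexp hc hd hr
  have hsup : (T + T').support.card ≤ d := by
    have := card_support_add_le T T'; omega
  by_cases hrel : Derivable g r d (T + T')
  · -- related: same class, factor through the common representative
    have hq : Quotient.mk s ⟨T, hT⟩ = Quotient.mk s ⟨T', hT'⟩ := Quotient.sound hrel
    have hcls : classOf hexp hc hd hr T = classOf hexp hc hd hr T' := by
      simp only [classOf, dif_pos hT, dif_pos hT']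
      exact congrArg some hq
    rw [if_pos hcls]
    simp only [classSign, dif_pos hT, dif_pos hT']
    set o := (Quotient.mk s ⟨T, hT⟩).out with ho
    have ho' : (Quotient.mk s ⟨T', hT'⟩).out = o := by rw [ho, hq]
    rw [ho']
    have hoT : Derivable g r d (o.1 + T) := by
      have : (s).r o ⟨T, hT⟩ := Quotient.exact (by rw [ho, Quotient.out_eq])
      exact this
    have hoT' : Derivable g r d (o.1 + T') := by
      have : (s).r o ⟨T', hT'⟩ := Quotient.exact (by rw [ho, hq, Quotient.out_eq])
      exact this
    have h1 : Derivable g r d (T + o.1) := by rwa [add_comm]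
    have hsup' : (T + o.1 + (o.1 + T')).support.card ≤ d := by
      rw [ParityVec.add_add_add_cancel]; exact hsup
    have := (pseudoMoment_add hexp hc hd hb h1 hoT' hsup').2
    rw [ParityVec.add_add_add_cancel] at this
    rw [this, add_comm o.1 T']
  · -- unrelated
    rw [pseudoMoment_of_not hrel]
    by_cases hcls : classOf hexp hc hd hr T = classOf hexp hc hd hr T'
    · exfalso
      simp only [classOf, dif_pos hT, dif_pos hT', Option.some.injEq] at hcls
      exact hrel (Quotient.exact hcls)
    · rw [if_neg hcls]

/-- **Positive semidefiniteness** (Grigoriev–Schoenebeck): for coefficients supported on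
half-degree monomials, `Σ_{T,T'} a_T a_{T'} Ẽ[y_{T+T'}] = Σ_{classes} (Σ_{T ∈ class} a_T χ(T))² ≥ 0`.
[Grigoriev 2001, Lemma 2; Schoenebeck 2008, Thm. 4.1 (proof); Barak–Steurer 2016] [folklore] -/
theorem pseudoMoment_quadratic_nonneg (hexp : VecExpands g r c) (hc : 0 < c)
    (hd : (d : ℝ) ≤ c * r / 2) (hr : 0 ≤ r) (hb : ∀ i, b i * b i = 1) (s : Finset ParityVec)
    (a : ParityVec → ℝ) (hs : ∀ T ∈ s, 2 * T.support.card ≤ d) :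
    0 ≤ ∑ T ∈ s, ∑ T' ∈ s, a T * a T' * pseudoMoment g b r d (T + T') := by
  classical
  set cl := classOf hexp hc hd hr with hcl
  set u : ParityVec → ℝ := fun T => a T * classSign b hexp hc hd hr T with hu
  have hterm : ∀ T ∈ s, ∀ T' ∈ s, a T * a T' * pseudoMoment g b r d (T + T') =
      if cl T = cl T' then u T * u T' else 0 := by
    intro T hT T' hT'
    rw [pseudoMoment_add_eq_classSign hexp hc hd hr hb (hs T hT) (hs T' hT')]
    split_ifs
    · simp only [hu]; ring
    · simp
  rw [Finset.sum_congr rfl fun T hT => Finset.sum_congr rfl fun T' hT' => hterm T hT T' hT']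
  -- regroup by classes
  have hfib : ∑ T ∈ s, ∑ T' ∈ s, (if cl T = cl T' then u T * u T' else 0) =
      ∑ q ∈ s.image cl, (∑ T ∈ s.filter (fun T => cl T = q), u T) *
        ∑ T' ∈ s.filter (fun T => cl T = q), u T' := by
    rw [← Finset.sum_fiberwise_of_maps_to (g := cl) (fun T hT => Finset.mem_image_of_mem cl hT)]
    refine Finset.sum_congr rfl fun q _ => ?_
    rw [Finset.sum_mul]
    refine Finset.sum_congr rfl fun T hT => ?_
    rw [Finset.mem_filter] at hT
    rw [Finset.mul_sum, Finset.sum_filter, hT.2]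
    refine Finset.sum_congr rfl fun T' _ => ?_
    exact if_congr eq_comm rfl rfl
  rw [hfib]
  exact Finset.sum_nonneg fun q _ => mul_self_nonneg _

end PSD

end Literature.Computability.MetaComplexity
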